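import Summits.BirchSwinnertonDyer.BirchSwinnertonDyer.Theorems.BiquadraticEisensteinDescentManinDatumSupercuspidalCMInertTameResolvent
import Literature.NumberTheory.EllipticCurves.WeierstrassPMultiplication
import Literature.NumberTheory.EllipticCurves.RealLatticePeriod
import Literature.NumberTheory.EllipticCurves.GaussianLatticeQuarterValues
import Literature.NumberTheory.EllipticCurves.LatticeJInvariant
import Mathlib.AlgebraicGeometry.EllipticCurve.DivisionPolynomial.Basic
import HarnessLib

set_option linter.dupNamespace false -- `Summit.BirchSwinnertonDyer.BirchSwinnertonDyer.Theorems.…` (summit = sub, D-0017)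
set_option autoImplicit false

/-!
# Crux `ManinDatumSupercuspidalCMInert` (stmt-BirchSwinnertonDyer-20111, BED r605), CM side of H₇ — step (c) of memo PLAIN-ODD-57 §3:
# the `7`-division polynomial of `y² = x³ − x` is EISENSTEIN AT `7` (supersingular reduction), so the `7`-division values of the
# lemniscatic `℘` have `7`-adic order exactly `−1/24` (and `x/y` has order `1/48`)

Route `BiquadraticEisensteinDescent` (cell `pub/bsd-wall`, width seat `bsd-wall-cm-bed-w4` g10, RESOLVENT LANE; `--supports`
stmt-BirchSwinnertonDyer-20111, helper). THEOREMS ONLY (no definition, no named fact, no `sorry`); nothing is closed by this file and BSD is not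
proved by any of it. Input of memo §3(c) «F = ℚ₇(i)(E₀[7]) is totally and tamely ramified of degree 48», in the valuation-theoretic form
that `…TameResolvent.resolvent_valuation_le` consumes (value group generated by `v(x/y)`, `v(x/y)^48 = v 7`):

* `preΨ'_seven_lemniscate` — **the `7`-division polynomial of `W₀ = ⟨0,0,0,−1,0⟩` (`y² = x³ − x`) EXPLICITLY**:
  `ψ₇ = 7X²⁴ − 308X²² − 2954X²⁰ + 19852X¹⁸ − 35231X¹⁶ + 82264X¹⁴ − 111916X¹² + 42168X¹⁰ + 15673X⁸ − 14756X⁶ + 1302X⁴ − 196X² − 1`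
  (Mathlib's `preΨ'` recursion `preΨ'_odd` at `5` and `7` over `Ψ₂Sq = 4X³ − 4X`, `Ψ₃ = 3X⁴ − 6X² − 1`, `preΨ₄ = 2X⁶ − 10X⁴ − 10X² + 2`);
  every coefficient but the constant `−1` is divisible by `7` — the reversed polynomial in `1/X²` is Eisenstein at `7` (supersingularity of
  `y² = x³ − x` at `7 ≡ 3 (mod 4)`); `ΨSq_seven_lemniscate`: `ΨSq₇ = ψ₇²`;
* `val_inv_pow_of_psi_seven` — for ANY valued field `(F, v)` with `v 7 < 1` and any root `x` of `ψ₇`: `x ≠ 0` and `v(x⁻¹)²⁴ = v 7`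
  (`…TameResolvent.valuation_root_of_eisenstein` on `u = x⁻²`, `n = 12`); with `y² = x³ − x` also `v(x/y)⁴⁸ = v 7` (`val_div_pow_of_psi_seven`);
* ★ `val_weierstrassP_seven_div` — **the `7`-division values of the Gaussian `℘`**: for `w ∉ Λ = ℤi + ℤ` with `7w ∈ Λ`,
  `x = ℘(w)/ϖ₀²`, `y = ℘′(w)/(2ϖ₀³)` satisfy `ψ₇(x) = 0`, `y² = x³ − x` (tree: `PeriodPair.aeval_weierstrassP_ΨSq_eq_zero` on `ϖ₀Λ`, whose
  curve is `y² = x³ − x`), hence for EVERY valuation `v` of `ℂ` with `v 7 < 1`: `v(x⁻¹)²⁴ = v 7` and `v(x/y)⁴⁸ = v 7`.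

References: [SilvermanAEC2009] Ex. 3.7, Prop. VI.3.6, Thm. V.3.1 (supersingular ⟺ no `p`-torsion); [Serre1979] Ch. I §6 (Eisenstein
polynomials); [CasselsFrohlich1967] Ch. I §6.
-/

noncomputable section

open Polynomial Complex

namespace Summit.BirchSwinnertonDyer.BirchSwinnertonDyer.Theorems.BiquadraticEisensteinDescentManinDatumSupercuspidalCMInertSevenDivisionEisenstein

open Summit.BirchSwinnertonDyer.BirchSwinnertonDyer.Theorems.BiquadraticEisensteinDescentManinDatumSupercuspidalCMInertTameResolvent
  (valuation_root_of_eisenstein)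

/-! ## §1 The division polynomials of `y² = x³ − x` up to `ψ₇` -/

/-- The `b`-invariants of `⟨0,0,0,−1,0⟩`: `b₂ = 0`, `b₄ = −2`, `b₆ = 0`, `b₈ = −1`. [folklore] -/
theorem b_lemniscate :
    (⟨0, 0, 0, -1, 0⟩ : WeierstrassCurve ℤ).b₂ = 0 ∧ (⟨0, 0, 0, -1, 0⟩ : WeierstrassCurve ℤ).b₄ = -2 ∧
    (⟨0, 0, 0, -1, 0⟩ : WeierstrassCurve ℤ).b₆ = 0 ∧ (⟨0, 0, 0, -1, 0⟩ : WeierstrassCurve ℤ).b₈ = -1 := by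
  refine ⟨?_, ?_, ?_, ?_⟩ <;>
  simp [WeierstrassCurve.b₂, WeierstrassCurve.b₄, WeierstrassCurve.b₆, WeierstrassCurve.b₈]

/-- `Ψ₂Sq = 4X³ − 4X` for `y² = x³ − x`. [folklore] -/
theorem Ψ₂Sq_lemniscate : (⟨0, 0, 0, -1, 0⟩ : WeierstrassCurve ℤ).Ψ₂Sq = 4 * X ^ 3 - 4 * X := by
  obtain ⟨h2, h4, h6, -⟩ := b_lemniscate
  rw [WeierstrassCurve.Ψ₂Sq, h2, h4, h6]
  simp; ring

/-- `ψ₃ = 3X⁴ − 6X² − 1` for `y² = x³ − x`. [folklore] -/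
theorem Ψ₃_lemniscate : (⟨0, 0, 0, -1, 0⟩ : WeierstrassCurve ℤ).Ψ₃ = 3 * X ^ 4 - 6 * X ^ 2 - 1 := by
  obtain ⟨h2, h4, h6, h8⟩ := b_lemniscate
  rw [WeierstrassCurve.Ψ₃, h2, h4, h6, h8]
  simp; ring

/-- `preΨ₄ = 2X⁶ − 10X⁴ − 10X² + 2` for `y² = x³ − x`. [folklore] -/
theorem preΨ₄_lemniscate :
    (⟨0, 0, 0, -1, 0⟩ : WeierstrassCurve ℤ).preΨ₄ = 2 * X ^ 6 - 10 * X ^ 4 - 10 * X ^ 2 + 2 := by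
  obtain ⟨h2, h4, h6, h8⟩ := b_lemniscate
  rw [WeierstrassCurve.preΨ₄, h2, h4, h6, h8]
  simp; ring

/-- **The `7`-division polynomial of `y² = x³ − x`**:
`ψ₇ = 7X²⁴ − 308X²² − 2954X²⁰ + 19852X¹⁸ − 35231X¹⁶ + 82264X¹⁴ − 111916X¹² + 42168X¹⁰ + 15673X⁸ − 14756X⁶ + 1302X⁴ − 196X² − 1`
(`ψ₅ = preΨ₄Ψ₂Sq² − ψ₃³`, `ψ₇ = ψ₅ψ₃³ − preΨ₄³Ψ₂Sq²`). All coefficients except the constant term are divisible by `7`.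
[cite: SilvermanAEC2009, Exercise 3.7 (p. 105)] -/
theorem preΨ'_seven_lemniscate : (⟨0, 0, 0, -1, 0⟩ : WeierstrassCurve ℤ).preΨ' 7 =
    7 * X ^ 24 - 308 * X ^ 22 - 2954 * X ^ 20 + 19852 * X ^ 18 - 35231 * X ^ 16 + 82264 * X ^ 14
      - 111916 * X ^ 12 + 42168 * X ^ 10 + 15673 * X ^ 8 - 14756 * X ^ 6 + 1302 * X ^ 4 - 196 * X ^ 2 - 1 := by
  set W : WeierstrassCurve ℤ := ⟨0, 0, 0, -1, 0⟩ with hW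
  have h5 : W.preΨ' 5 = W.preΨ₄ * W.Ψ₂Sq ^ 2 - W.Ψ₃ ^ 3 := by
    rw [show (5 : ℕ) = 2 * (0 + 2) + 1 from rfl, W.preΨ'_odd 0]
    simp
  have h7 : W.preΨ' 7 = W.preΨ' 5 * W.Ψ₃ ^ 3 - W.preΨ₄ ^ 3 * W.Ψ₂Sq ^ 2 := by
    rw [show (7 : ℕ) = 2 * (1 + 2) + 1 from rfl, W.preΨ'_odd 1]
    simp
  rw [h7, h5, hW, Ψ₂Sq_lemniscate, Ψ₃_lemniscate, preΨ₄_lemniscate]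
  ring

/-- `ΨSq₇ = ψ₇²` for `y² = x³ − x` (`7` is odd). [folklore] -/
theorem ΨSq_seven_lemniscate : (⟨0, 0, 0, -1, 0⟩ : WeierstrassCurve ℤ).ΨSq ((7 : ℕ) : ℤ) =
    (⟨0, 0, 0, -1, 0⟩ : WeierstrassCurve ℤ).preΨ' 7 ^ 2 := by
  rw [WeierstrassCurve.ΨSq_ofNat]
  simp [show ¬ Even 7 by decide]

/-! ## §2 Eisenstein at `7`: roots of `ψ₇` in a valued field -/

section Valued

variable {F Γ₀ : Type*} [Field F] [LinearOrderedCommGroupWithZero Γ₀] (v : Valuation F Γ₀)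

/-- Integers have valuation `≤ 1`. [folklore] -/
theorem val_intCast_le_one (m : ℤ) : v (m : F) ≤ 1 := by
  have hnat : ∀ n : ℕ, v (n : F) ≤ 1 := by
    intro n
    induction n with
    | zero => simp
    | succ n ih =>
      rw [Nat.cast_succ]
      exact Valuation.map_add_le v ih (by rw [Valuation.map_one])
  rcases Int.eq_nat_or_neg m with ⟨n, rfl | rfl⟩
  · exact_mod_cast hnat n
  · rw [Int.cast_neg, Valuation.map_neg]; exact_mod_cast hnat n

/-- **Roots of `ψ₇` have `v(x⁻¹)²⁴ = v 7`.** If `v 7 < 1` and `x` satisfies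
`7x²⁴ − 308x²² − ⋯ − 196x² − 1 = 0` in `F`, then `x ≠ 0` and `v(x⁻¹)²⁴ = v 7`: the polynomial in `u = x⁻²`,
`u¹² + 196u¹¹ − 1302u¹⁰ + ⋯ + 308u − 7`, is Eisenstein at `7`. [cite: Serre1979, Ch. I §6] [cite: SilvermanAEC2009, Thm. V.3.1] -/
theorem val_inv_pow_of_psi_seven (h7 : v 7 < 1) {x : F}
    (hx : 7 * x ^ 24 - 308 * x ^ 22 - 2954 * x ^ 20 + 19852 * x ^ 18 - 35231 * x ^ 16 + 82264 * x ^ 14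
      - 111916 * x ^ 12 + 42168 * x ^ 10 + 15673 * x ^ 8 - 14756 * x ^ 6 + 1302 * x ^ 4 - 196 * x ^ 2 - 1 = 0) :
    x ≠ 0 ∧ v x⁻¹ ^ 24 = v 7 := by
  have hx0 : x ≠ 0 := by
    rintro rfl
    norm_num at hx
  refine ⟨hx0, ?_⟩
  -- the coefficients `a_i` of `u¹² = −Σ a_i u^i`, `u = x⁻²`: `a_i = 7 · m_i`
  let m : ℕ → ℤ := fun i ↦
    if i = 0 then -1 else if i = 1 then 44 else if i = 2 then 422 else if i = 3 then -2836 else if i = 4 then 5033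
    else if i = 5 then -11752 else if i = 6 then 15988 else if i = 7 then -6024 else if i = 8 then -2239
    else if i = 9 then 2108 else if i = 10 then -186 else if i = 11 then 28 else 0
  let a : ℕ → F := fun i ↦ 7 * ((m i : ℤ) : F)
  have ha0 : a 0 = -7 := by simp [a, m]
  have hroot : (x⁻¹ ^ 2) ^ 12 = -∑ i ∈ Finset.range 12, a i * (x⁻¹ ^ 2) ^ i := by
    simp only [Finset.sum_range_succ, Finset.sum_range_zero, a, m]
    simp only [show (1:ℕ) ≠ 0 from one_ne_zero, if_true, if_false]
    norm_num
    field_simp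
    linear_combination (-1 : F) * hx
  have hbound : ∀ i < 12, v (a i) ≤ v (a 0) := by
    intro i _
    rw [ha0, Valuation.map_neg]
    show v (7 * ((m i : ℤ) : F)) ≤ v 7
    rw [Valuation.map_mul]
    exact mul_le_of_le_one_right' (val_intCast_le_one v (m i))
  have hlt : v (a 0) < 1 := by rw [ha0, Valuation.map_neg]; exact h7
  have h := valuation_root_of_eisenstein v (n := 12) (by norm_num) a hroot hbound hlt
  rw [ha0, Valuation.map_neg, Valuation.map_pow, ← pow_mul] at h
  exact h

/-- **The uniformiser power**: under the same hypotheses and `y² = x³ − x`, `v(x/y)⁴⁸ = v 7` (and `y ≠ 0`): `v(y)² = v(x)³`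
since `v(x⁻²) < 1`. (In `ℚ₇(i)(E₀[7])`: `x/y` has normalised order `1/48`, the extension is totally ramified of degree `48`.)
[cite: Serre1979, Ch. I §6] -/
theorem val_div_pow_of_psi_seven (h7 : v 7 < 1) {x y : F}
    (hx : 7 * x ^ 24 - 308 * x ^ 22 - 2954 * x ^ 20 + 19852 * x ^ 18 - 35231 * x ^ 16 + 82264 * x ^ 14
      - 111916 * x ^ 12 + 42168 * x ^ 10 + 15673 * x ^ 8 - 14756 * x ^ 6 + 1302 * x ^ 4 - 196 * x ^ 2 - 1 = 0)
    (hy : y ^ 2 = x ^ 3 - x) : y ≠ 0 ∧ v (x / y) ^ 48 = v 7 := by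
  obtain ⟨hx0, hval⟩ := val_inv_pow_of_psi_seven v h7 hx
  have hvx0 : v x ≠ 0 := (Valuation.ne_zero_iff v).mpr hx0
  -- `v x⁻¹ < 1`
  have hxinv : v x⁻¹ < 1 := by
    by_contra hge
    push Not at hge
    have : (1 : Γ₀) ≤ v x⁻¹ ^ 24 := one_le_pow₀ hge
    rw [hval] at this
    exact absurd h7 (not_lt.mpr this)
  -- `v (1 − x⁻²) = 1`, so `v y ^ 2 = v x ^ 3`
  have h1 : v (1 - x⁻¹ ^ 2) = 1 := by
    rw [sub_eq_add_neg]
    refine Valuation.map_one_add_of_lt v ?_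
    rw [Valuation.map_neg, Valuation.map_pow]
    exact pow_lt_one₀ zero_le hxinv (by norm_num)
  have hy2 : v y ^ 2 = v x ^ 3 := by
    have : y ^ 2 = x ^ 3 * (1 - x⁻¹ ^ 2) := by rw [hy]; field_simp
    rw [← Valuation.map_pow, this, Valuation.map_mul, h1, mul_one, Valuation.map_pow]
  have hy0 : y ≠ 0 := by
    intro h0
    rw [h0, Valuation.map_zero, zero_pow two_ne_zero] at hy2
    exact pow_ne_zero 3 hvx0 hy2.symm
  refine ⟨hy0, ?_⟩
  have hvy0 : v y ≠ 0 := (Valuation.ne_zero_iff v).mpr hy0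
  -- `v (x/y) ^ 48 = v x ^ 48 / v y ^ 48 = v x ^ 48 / v x ^ 72 = (v x⁻¹) ^ 24`
  rw [map_div₀, div_pow, show (48 : ℕ) = 2 * 24 from rfl, pow_mul (v y), hy2, ← pow_mul, ← hval, map_inv₀, inv_pow]
  have hx48 : v x ^ 48 ≠ 0 := pow_ne_zero _ hvx0
  rw [div_eq_iff (pow_ne_zero _ hvx0), show (3 * 24 : ℕ) = 24 + 2 * 24 from rfl, pow_add,
    ← mul_assoc, inv_mul_cancel₀ (pow_ne_zero _ hvx0), one_mul]

end Valued

/-! ## §3 The `7`-division values of the lemniscatic `℘` -/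

section Analytic

open scoped PeriodPair
open PeriodPair Literature.NumberTheory.EllipticCurves Literature.NumberTheory.EllipticCurves.GaussianLattice

/-- **The `7`-division values of the Gaussian `℘` are roots of `ψ₇` and lie on `y² = x³ − x`.** For `w ∉ Λ = ℤi + ℤ` with `7w ∈ Λ`,
`x = ℘(w)/ϖ₀²` and `y = ℘′(w)/(2ϖ₀³)` (`ϖ₀ = Γ(1/4)²/(2√(2π))`) satisfy `ψ₇(x) = 0` and `y² = x³ − x` (the curve of the lattice `ϖ₀Λ` is
`y² = x³ − x`: `g₂(ϖ₀Λ) = 4`, `g₃ = 0`; `PeriodPair.aeval_weierstrassP_ΨSq_eq_zero`, `ΨSq₇ = ψ₇²`).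
[cite: SilvermanAEC2009, Exercise 3.7 (f) and Prop. VI.3.6 (b)] -/
theorem psi_seven_weierstrassP_div {w : ℂ} (hw : w ∉ (ofUpperHalfPlane UpperHalfPlane.I).lattice)
    (h7w : (7 : ℂ) * w ∈ (ofUpperHalfPlane UpperHalfPlane.I).lattice) :
    (7 * (℘[ofUpperHalfPlane UpperHalfPlane.I] w / ((Real.Gamma (1 / 4) ^ 2 / (2 * Real.sqrt (2 * Real.pi)) : ℝ) : ℂ) ^ 2) ^ 24
      - 308 * (℘[ofUpperHalfPlane UpperHalfPlane.I] w / ((Real.Gamma (1 / 4) ^ 2 / (2 * Real.sqrt (2 * Real.pi)) : ℝ) : ℂ) ^ 2) ^ 22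
      - 2954 * (℘[ofUpperHalfPlane UpperHalfPlane.I] w / ((Real.Gamma (1 / 4) ^ 2 / (2 * Real.sqrt (2 * Real.pi)) : ℝ) : ℂ) ^ 2) ^ 20
      + 19852 * (℘[ofUpperHalfPlane UpperHalfPlane.I] w / ((Real.Gamma (1 / 4) ^ 2 / (2 * Real.sqrt (2 * Real.pi)) : ℝ) : ℂ) ^ 2) ^ 18
      - 35231 * (℘[ofUpperHalfPlane UpperHalfPlane.I] w / ((Real.Gamma (1 / 4) ^ 2 / (2 * Real.sqrt (2 * Real.pi)) : ℝ) : ℂ) ^ 2) ^ 16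
      + 82264 * (℘[ofUpperHalfPlane UpperHalfPlane.I] w / ((Real.Gamma (1 / 4) ^ 2 / (2 * Real.sqrt (2 * Real.pi)) : ℝ) : ℂ) ^ 2) ^ 14
      - 111916 * (℘[ofUpperHalfPlane UpperHalfPlane.I] w / ((Real.Gamma (1 / 4) ^ 2 / (2 * Real.sqrt (2 * Real.pi)) : ℝ) : ℂ) ^ 2) ^ 12
      + 42168 * (℘[ofUpperHalfPlane UpperHalfPlane.I] w / ((Real.Gamma (1 / 4) ^ 2 / (2 * Real.sqrt (2 * Real.pi)) : ℝ) : ℂ) ^ 2) ^ 10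
      + 15673 * (℘[ofUpperHalfPlane UpperHalfPlane.I] w / ((Real.Gamma (1 / 4) ^ 2 / (2 * Real.sqrt (2 * Real.pi)) : ℝ) : ℂ) ^ 2) ^ 8
      - 14756 * (℘[ofUpperHalfPlane UpperHalfPlane.I] w / ((Real.Gamma (1 / 4) ^ 2 / (2 * Real.sqrt (2 * Real.pi)) : ℝ) : ℂ) ^ 2) ^ 6
      + 1302 * (℘[ofUpperHalfPlane UpperHalfPlane.I] w / ((Real.Gamma (1 / 4) ^ 2 / (2 * Real.sqrt (2 * Real.pi)) : ℝ) : ℂ) ^ 2) ^ 4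
      - 196 * (℘[ofUpperHalfPlane UpperHalfPlane.I] w / ((Real.Gamma (1 / 4) ^ 2 / (2 * Real.sqrt (2 * Real.pi)) : ℝ) : ℂ) ^ 2) ^ 2
      - 1 = 0) ∧
    (℘'[ofUpperHalfPlane UpperHalfPlane.I] w / (2 * ((Real.Gamma (1 / 4) ^ 2 / (2 * Real.sqrt (2 * Real.pi)) : ℝ) : ℂ) ^ 3)) ^ 2 =
      (℘[ofUpperHalfPlane UpperHalfPlane.I] w / ((Real.Gamma (1 / 4) ^ 2 / (2 * Real.sqrt (2 * Real.pi)) : ℝ) : ℂ) ^ 2) ^ 3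
        - ℘[ofUpperHalfPlane UpperHalfPlane.I] w / ((Real.Gamma (1 / 4) ^ 2 / (2 * Real.sqrt (2 * Real.pi)) : ℝ) : ℂ) ^ 2 := by
  set ϖ : ℂ := ((Real.Gamma (1 / 4) ^ 2 / (2 * Real.sqrt (2 * Real.pi)) : ℝ) : ℂ) with hϖ
  set x : ℂ := ℘[ofUpperHalfPlane UpperHalfPlane.I] w / ϖ ^ 2 with hx
  have hϖ0 : ϖ ≠ 0 := Complex.ofReal_ne_zero.mpr varpi_pos.ne'
  set L' : PeriodPair := (ofUpperHalfPlane UpperHalfPlane.I).mulLeft ϖ hϖ0 with hL'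
  have hg2 : L'.g₂ = 4 := by
    rw [hL', PeriodPair.g₂_mulLeft, g₂_eq_varpi', ← hϖ]
    field_simp
  have hg3 : L'.g₃ = 0 := by
    rw [hL', PeriodPair.g₃_mulLeft, g₃_ofUpperHalfPlane_I, mul_zero]
  have hW : (⟨0, 0, 0, -1, 0⟩ : WeierstrassCurve ℤ).map (algebraMap ℤ ℂ) = L'.curve :=
    PeriodPair.map_eq_curve (by rw [hg2]; norm_num) (by rw [hg3]; norm_num)
  have hw' : ϖ * w ∉ L'.lattice := by
    rw [hL', PeriodPair.mul_mem_mulLeft_lattice]; exact hw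
  have hnw' : (((7 : ℕ) : ℤ) : ℂ) * (ϖ * w) ∈ L'.lattice := by
    rw [show (((7 : ℕ) : ℤ) : ℂ) * (ϖ * w) = ϖ * ((7 : ℂ) * w) by push_cast; ring, hL',
      PeriodPair.mul_mem_mulLeft_lattice]
    exact h7w
  have hroot := PeriodPair.aeval_weierstrassP_ΨSq_eq_zero hW hw' hnw'
  have hPw : ℘[L'] (ϖ * w) = x := by
    rw [hL', PeriodPair.weierstrassP_mulLeft, hx, div_eq_inv_mul]
  rw [hPw, ΨSq_seven_lemniscate, map_pow, pow_eq_zero_iff two_ne_zero, preΨ'_seven_lemniscate] at hroot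
  refine ⟨?_, ?_⟩
  · have h := hroot
    simp only [map_sub, map_add, map_mul, map_pow, aeval_X, map_one, map_ofNat] at h
    linear_combination h
  · -- `(℘'/2ϖ³)² = (℘/ϖ²)³ − ℘/ϖ²` from `℘'² = 4℘³ − g₂℘`, `g₂ = 4ϖ⁴`
    have hQ := (ofUpperHalfPlane UpperHalfPlane.I).derivWeierstrassP_sq w hw
    rw [g₂_eq_varpi', g₃_ofUpperHalfPlane_I, sub_zero, ← hϖ] at hQ
    rw [hx]
    field_simp
    linear_combination hQ

/-- ★ **The `7`-adic order of the `7`-division values of the lemniscatic `℘`.** For `w ∉ Λ = ℤi + ℤ` with `7w ∈ Λ` and EVERY valuation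
`v` of `ℂ` with `v 7 < 1` (e.g. the `7`-adic absolute value transported along `ι′ : ℂ₇ ≃ ℂ`): `x = ℘(w)/ϖ₀²`, `y = ℘′(w)/(2ϖ₀³)` satisfy
`x ≠ 0`, `y ≠ 0`, `v(x⁻¹)²⁴ = v 7` and `v(x/y)⁴⁸ = v 7` — normalised orders `−1/24`, `−1/16` and `1/48` for `x`, `y`, `x/y`: the `7`-torsion
layer of `y² = x³ − x` over `ℚ₇(i)` is totally ramified of degree `48` (memo PLAIN-ODD-57 §3 (c)). [cite: SilvermanAEC2009, Thm. V.3.1]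
[cite: Serre1979, Ch. I §6] -/
theorem val_weierstrassP_seven_div {Γ₀ : Type*} [LinearOrderedCommGroupWithZero Γ₀] (v : Valuation ℂ Γ₀) (h7 : v 7 < 1)
    {w : ℂ} (hw : w ∉ (ofUpperHalfPlane UpperHalfPlane.I).lattice)
    (h7w : (7 : ℂ) * w ∈ (ofUpperHalfPlane UpperHalfPlane.I).lattice) :
    ℘[ofUpperHalfPlane UpperHalfPlane.I] w / ((Real.Gamma (1 / 4) ^ 2 / (2 * Real.sqrt (2 * Real.pi)) : ℝ) : ℂ) ^ 2 ≠ 0 ∧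
    ℘'[ofUpperHalfPlane UpperHalfPlane.I] w / (2 * ((Real.Gamma (1 / 4) ^ 2 / (2 * Real.sqrt (2 * Real.pi)) : ℝ) : ℂ) ^ 3) ≠ 0 ∧
    v (℘[ofUpperHalfPlane UpperHalfPlane.I] w / ((Real.Gamma (1 / 4) ^ 2 / (2 * Real.sqrt (2 * Real.pi)) : ℝ) : ℂ) ^ 2)⁻¹ ^ 24 = v 7 ∧
    v ((℘[ofUpperHalfPlane UpperHalfPlane.I] w / ((Real.Gamma (1 / 4) ^ 2 / (2 * Real.sqrt (2 * Real.pi)) : ℝ) : ℂ) ^ 2) /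
        (℘'[ofUpperHalfPlane UpperHalfPlane.I] w / (2 * ((Real.Gamma (1 / 4) ^ 2 / (2 * Real.sqrt (2 * Real.pi)) : ℝ) : ℂ) ^ 3))) ^ 48
      = v 7 := by
  obtain ⟨hx, hy⟩ := psi_seven_weierstrassP_div hw h7w
  obtain ⟨hx0, hvx⟩ := val_inv_pow_of_psi_seven v h7 hx
  obtain ⟨hy0, hvy⟩ := val_div_pow_of_psi_seven v h7 hx hy
  exact ⟨hx0, hy0, hvx, hvy⟩

end Analytic

end Summit.BirchSwinnertonDyer.BirchSwinnertonDyer.Theorems.BiquadraticEisensteinDescentManinDatumSupercuspidalCMInertSevenDivisionEisenstein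

end
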